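import Mathlib
import HarnessLib

/-!
# A global Lipschitz perturbation of a dilation is onto, bi-Lipschitz, and pushes Lebesgue measure on a ball onto a multiple of Lebesgue measure on a ball

HONEST FRAMING: exact (Metropolis-corrected) sampling algorithms for lattice gauge theory;
figures of merit are autocorrelation/cost numbers at stated couplings and volumes; no
continuum-physics claim.

Venture `LatticeQCDFlow` (cell pub-lqcd), topic `Exactness`, FANOUT row 9 (eng-latcore; the
measure-theoretic half of the multi-step leapfrog HMC Doeblin argument, `LeapfrogShortTrajectory.lean`
being the analytic half).  NEW WORK of the cell over Mathlib (`ContractingWith.fixedPoint` — Banach's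
fixed point theorem; `LipschitzWith.hausdorffMeasure_image_le` and `hausdorffMeasure_pi_real` —
Lebesgue measure on `ι → ℝ` is the `|ι|`-dimensional Hausdorff measure of the sup metric, so a
`L`-Lipschitz map inflates volumes by at most `L^{|ι|}`); nothing here is cited as a fact.
Printed counterpart, named only: the Lipschitz inverse function theorem (Hadamard; e.g. the
`ApproximatesLinearOn` chapter of Mathlib, which we do not need in this global, derivative-free form).

Setting: `Ψ : (ι → ℝ) → (ι → ℝ)` (sup norm), a real `τ > c ≥ 0` and the single hypothesis
`(A)  ‖Ψ p − Ψ p' − τ•(p − p')‖ ≤ c‖p − p'‖` for all `p, p'`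
(for the `n`-step leapfrog position map: `τ = nδ`, `c = τ/3`, `LeapfrogShortTrajectory.lfTraj_pos_approx`).

* `norm_sub_le_of_approx` / `le_norm_sub_of_approx` — `(τ − c)‖p − p'‖ ≤ ‖Ψ p − Ψ p'‖ ≤ (τ + c)‖p − p'‖`;
  `lipschitzWith_of_approx`;
* **`surjective_of_approx`** — `Ψ` is ONTO (`q ↦ q − τ⁻¹(Ψ q − y)` is a `c/τ`-contraction);
* `volume_image_le_of_lipschitz` — `vol(Ψ '' S) ≤ (τ + c)^{|ι|} vol(S)`;
* **`smul_restrict_ball_le_map_of_approx`** — for `r ≤ (τ − c) R`: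
  `(τ + c)^{−|ι|} • vol|_{ball (Ψ 0) r} ≤ (vol|_{ball 0 R}) ∘ Ψ⁻¹` — Lebesgue measure on the
  momentum ball of radius `R`, pushed through `Ψ`, DOMINATES a multiple of Lebesgue measure on the
  ball of radius `r` about `Ψ 0` (every point there is hit, from inside the momentum ball, and volumes
  are compared through the Lipschitz bound);
  `smul_restrict_ball_zero_le_map_of_approx` — the same about the origin: if `‖Ψ 0‖ ≤ D` and
  `r + D ≤ (τ − c) R` then `(τ + c)^{−|ι|} • vol|_{ball 0 r} ≤ (vol|_{ball 0 R}) ∘ Ψ⁻¹`.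

NOT here: anything about HMC (the files that use this: `U1MultiStepLeapfrogHMC.lean`); sharper
constants (the true Jacobian); other norms on `ℝ^ι` (the sup norm is what `Measure.pi`'s balls are).
-/

noncomputable section

namespace Summit.Ventures.LatticeQCDFlow.Exactness

open MeasureTheory Measure Set Metric Function
open scoped ENNReal NNReal

variable {ι : Type*} [Fintype ι]

section ApproxDilation

variable {Ψ : (ι → ℝ) → (ι → ℝ)} {τ c : ℝ}

/-- **Upper Lipschitz bound** from `(A)`: `‖Ψ p − Ψ p'‖ ≤ (τ + c)‖p − p'‖` (`τ ≥ 0`). -/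
theorem norm_sub_le_of_approx (hτ : 0 ≤ τ)
    (h : ∀ p p', ‖Ψ p - Ψ p' - τ • (p - p')‖ ≤ c * ‖p - p'‖) (p p' : ι → ℝ) :
    ‖Ψ p - Ψ p'‖ ≤ (τ + c) * ‖p - p'‖ := by
  calc ‖Ψ p - Ψ p'‖ = ‖(Ψ p - Ψ p' - τ • (p - p')) + τ • (p - p')‖ := by rw [sub_add_cancel]
    _ ≤ ‖Ψ p - Ψ p' - τ • (p - p')‖ + ‖τ • (p - p')‖ := norm_add_le _ _
    _ ≤ c * ‖p - p'‖ + τ * ‖p - p'‖ := by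
        rw [norm_smul, Real.norm_of_nonneg hτ]
        exact add_le_add (h p p') le_rfl
    _ = (τ + c) * ‖p - p'‖ := by ring

/-- **Lower (expansion) bound** from `(A)`: `(τ − c)‖p − p'‖ ≤ ‖Ψ p − Ψ p'‖` (`τ ≥ 0`). -/
theorem le_norm_sub_of_approx (hτ : 0 ≤ τ)
    (h : ∀ p p', ‖Ψ p - Ψ p' - τ • (p - p')‖ ≤ c * ‖p - p'‖) (p p' : ι → ℝ) :
    (τ - c) * ‖p - p'‖ ≤ ‖Ψ p - Ψ p'‖ := by
  have htri : ‖τ • (p - p')‖ ≤ ‖Ψ p - Ψ p'‖ + ‖Ψ p - Ψ p' - τ • (p - p')‖ := by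
    calc ‖τ • (p - p')‖ = ‖(Ψ p - Ψ p') - (Ψ p - Ψ p' - τ • (p - p'))‖ := by rw [sub_sub_cancel]
      _ ≤ _ := norm_sub_le _ _
  rw [norm_smul, Real.norm_of_nonneg hτ] at htri
  have := h p p'
  nlinarith

/-- `Ψ` is `(τ + c)`-Lipschitz (`τ, c ≥ 0`). -/
theorem lipschitzWith_of_approx (hτ : 0 ≤ τ) (hc : 0 ≤ c)
    (h : ∀ p p', ‖Ψ p - Ψ p' - τ • (p - p')‖ ≤ c * ‖p - p'‖) :
    LipschitzWith (Real.toNNReal (τ + c)) Ψ :=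
  LipschitzWith.of_dist_le_mul fun p p' => by
    rw [dist_eq_norm, dist_eq_norm, Real.coe_toNNReal _ (add_nonneg hτ hc)]
    exact norm_sub_le_of_approx hτ h p p'

/-- `Ψ` is continuous. -/
theorem continuous_of_approx (hτ : 0 ≤ τ) (hc : 0 ≤ c)
    (h : ∀ p p', ‖Ψ p - Ψ p' - τ • (p - p')‖ ≤ c * ‖p - p'‖) : Continuous Ψ :=
  (lipschitzWith_of_approx hτ hc h).continuous

/-- **`Ψ` IS ONTO** (`0 ≤ c < τ`): for every `y` the map `q ↦ q − τ⁻¹•(Ψ q − y)` is a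
`c/τ`-contraction of the complete space `ι → ℝ`, and its fixed point solves `Ψ q = y` (Banach). -/
theorem surjective_of_approx (hcτ : c < τ) (hc : 0 ≤ c)
    (h : ∀ p p', ‖Ψ p - Ψ p' - τ • (p - p')‖ ≤ c * ‖p - p'‖) : Surjective Ψ := by
  have hτ : 0 < τ := hc.trans_lt hcτ
  intro y
  set T : (ι → ℝ) → (ι → ℝ) := fun q => q - τ⁻¹ • (Ψ q - y) with hT
  have hK0 : 0 ≤ c / τ := div_nonneg hc hτ.le
  have hlip : LipschitzWith (Real.toNNReal (c / τ)) T := by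
    refine LipschitzWith.of_dist_le_mul fun q q' => ?_
    rw [dist_eq_norm, dist_eq_norm, Real.coe_toNNReal _ hK0]
    have hid : T q - T q' = -(τ⁻¹ • (Ψ q - Ψ q' - τ • (q - q'))) := by
      simp only [hT, smul_sub, smul_smul, inv_mul_cancel₀ hτ.ne', one_smul]
      abel
    rw [hid, norm_neg, norm_smul, Real.norm_of_nonneg (inv_nonneg.2 hτ.le)]
    calc τ⁻¹ * ‖Ψ q - Ψ q' - τ • (q - q')‖ ≤ τ⁻¹ * (c * ‖q - q'‖) :=
          mul_le_mul_of_nonneg_left (h q q') (inv_nonneg.2 hτ.le)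
      _ = c / τ * ‖q - q'‖ := by rw [div_eq_inv_mul]; ring
  have hcon : ContractingWith (Real.toNNReal (c / τ)) T :=
    ⟨by rw [← NNReal.coe_lt_coe, Real.coe_toNNReal _ hK0, NNReal.coe_one]
        exact (div_lt_one hτ).2 hcτ, hlip⟩
  refine ⟨ContractingWith.fixedPoint T hcon, ?_⟩
  set q := ContractingWith.fixedPoint T hcon with hq
  have hfix : T q = q := ContractingWith.fixedPoint_isFixedPt (f := T) hcon
  have h0 : τ⁻¹ • (Ψ q - y) = 0 := by
    have h1 : q - τ⁻¹ • (Ψ q - y) = q := hfix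
    exact sub_eq_self.1 h1
  rw [smul_eq_zero, inv_eq_zero] at h0
  rcases h0 with h0 | h0
  · exact absurd h0 hτ.ne'
  · exact sub_eq_zero.1 h0

end ApproxDilation

/-! ## The push-forward of Lebesgue measure on a ball -/

section Pushforward

variable {Ψ : (ι → ℝ) → (ι → ℝ)} {τ c : ℝ}

/-- **Lipschitz maps inflate Lebesgue measure on `ι → ℝ` by at most `L^{|ι|}`** (Lebesgue measure
is the `|ι|`-dimensional Hausdorff measure of the sup metric, `hausdorffMeasure_pi_real`). -/
theorem volume_image_le_of_lipschitz {L : ℝ≥0} {f : (ι → ℝ) → (ι → ℝ)} (hf : LipschitzWith L f)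
    (S : Set (ι → ℝ)) :
    volume (f '' S) ≤ (L : ℝ≥0∞) ^ Fintype.card ι * volume S := by
  have h := hf.hausdorffMeasure_image_le (d := (Fintype.card ι : ℝ)) (Nat.cast_nonneg _) S
  rw [hausdorffMeasure_pi_real, ENNReal.rpow_natCast] at h
  exact h

/-- **THE PUSH-FORWARD OF LEBESGUE MEASURE ON THE MOMENTUM BALL DOMINATES LEBESGUE MEASURE ON A BALL
ABOUT `Ψ 0`.**  Under `(A)` with `0 ≤ c < τ` and `r ≤ (τ − c) R`:
`(τ + c)^{−|ι|} • vol|_{ball (Ψ 0) r} ≤ (vol|_{ball 0 R}).map Ψ`. -/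
theorem smul_restrict_ball_le_map_of_approx (hcτ : c < τ) (hc : 0 ≤ c)
    (h : ∀ p p', ‖Ψ p - Ψ p' - τ • (p - p')‖ ≤ c * ‖p - p'‖) {r R : ℝ}
    (hR : r ≤ (τ - c) * R) :
    ENNReal.ofReal ((τ + c)⁻¹ ^ Fintype.card ι) • volume.restrict (ball (Ψ 0) r) ≤
      (volume.restrict (ball (0 : ι → ℝ) R)).map Ψ := by
  have hτ : 0 < τ := hc.trans_lt hcτ
  have hτc : 0 < τ - c := sub_pos.2 hcτ
  have hτc' : 0 < τ + c := by linarith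
  have hΨm : Measurable Ψ := (continuous_of_approx hτ.le hc h).measurable
  have hsurj : Surjective Ψ := surjective_of_approx hcτ hc h
  refine Measure.le_iff.2 fun A hA => ?_
  rw [Measure.smul_apply, smul_eq_mul, Measure.restrict_apply hA, Measure.map_apply hΨm hA,
    Measure.restrict_apply (hΨm hA)]
  -- the set of momenta that hit `A ∩ ball (Ψ 0) r`
  set S : Set (ι → ℝ) := Ψ ⁻¹' (A ∩ ball (Ψ 0) r) with hS
  have hSsub : S ⊆ Ψ ⁻¹' A ∩ ball 0 R := by
    intro p hp
    rw [hS, mem_preimage] at hp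
    refine ⟨hp.1, mem_ball_zero_iff.2 ?_⟩
    have hlow := le_norm_sub_of_approx hτ.le h p 0
    rw [sub_zero] at hlow
    have hlt : ‖Ψ p - Ψ 0‖ < r := by rw [← dist_eq_norm]; exact mem_ball.1 hp.2
    exact lt_of_mul_lt_mul_left (hlow.trans_lt (hlt.trans_le hR)) hτc.le
  have himage : Ψ '' S = A ∩ ball (Ψ 0) r := by rw [hS, image_preimage_eq _ hsurj]
  have hvol : volume (A ∩ ball (Ψ 0) r) ≤ ENNReal.ofReal ((τ + c) ^ Fintype.card ι) * volume S := by
    rw [← himage]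
    refine (volume_image_le_of_lipschitz (lipschitzWith_of_approx hτ.le hc h) S).trans ?_
    rw [ENNReal.ofReal_pow hτc'.le]
    rfl
  calc ENNReal.ofReal ((τ + c)⁻¹ ^ Fintype.card ι) * volume (A ∩ ball (Ψ 0) r)
      ≤ ENNReal.ofReal ((τ + c)⁻¹ ^ Fintype.card ι) *
          (ENNReal.ofReal ((τ + c) ^ Fintype.card ι) * volume S) := by gcongr
    _ = volume S := by
        rw [← mul_assoc, ← ENNReal.ofReal_mul (pow_nonneg (inv_nonneg.2 hτc'.le) _), ← mul_pow,
          inv_mul_cancel₀ hτc'.ne', one_pow, ENNReal.ofReal_one, one_mul]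
    _ ≤ volume (Ψ ⁻¹' A ∩ ball 0 R) := measure_mono hSsub

/-- **The same about the origin**: if moreover `‖Ψ 0‖ ≤ D` and `r + D ≤ (τ − c) R`, then
`(τ + c)^{−|ι|} • vol|_{ball 0 r} ≤ (vol|_{ball 0 R}).map Ψ` (the ball `ball 0 r` sits inside
`ball (Ψ 0) (r + D)`). -/
theorem smul_restrict_ball_zero_le_map_of_approx (hcτ : c < τ) (hc : 0 ≤ c)
    (h : ∀ p p', ‖Ψ p - Ψ p' - τ • (p - p')‖ ≤ c * ‖p - p'‖) {r R D : ℝ} (hD : ‖Ψ 0‖ ≤ D)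
    (hR : r + D ≤ (τ - c) * R) :
    ENNReal.ofReal ((τ + c)⁻¹ ^ Fintype.card ι) • volume.restrict (ball (0 : ι → ℝ) r) ≤
      (volume.restrict (ball (0 : ι → ℝ) R)).map Ψ := by
  have hsub : ball (0 : ι → ℝ) r ⊆ ball (Ψ 0) (r + D) := by
    intro q hq
    rw [mem_ball, dist_eq_norm] at hq ⊢
    rw [sub_zero] at hq
    calc ‖q - Ψ 0‖ ≤ ‖q‖ + ‖Ψ 0‖ := norm_sub_le _ _
      _ < r + D := add_lt_add_of_lt_of_le hq hD
  calc ENNReal.ofReal ((τ + c)⁻¹ ^ Fintype.card ι) • volume.restrict (ball (0 : ι → ℝ) r)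
      ≤ ENNReal.ofReal ((τ + c)⁻¹ ^ Fintype.card ι) • volume.restrict (ball (Ψ 0) (r + D)) := by
        refine Measure.le_iff'.2 fun A => ?_
        simp only [Measure.smul_apply, smul_eq_mul]
        exact mul_le_mul' le_rfl (Measure.restrict_mono hsub le_rfl A)
    _ ≤ (volume.restrict (ball (0 : ι → ℝ) R)).map Ψ :=
        smul_restrict_ball_le_map_of_approx hcτ hc h hR

end Pushforward

end Summit.Ventures.LatticeQCDFlow.Exactness
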